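/-
Copyright (c) 2026 the pub-hodgecm-mathlib formalisation cell (harness21).  Prover seat hodgecm-mathlib-K2E4-p10 (g8), Track B «K2-LIT»,
#184♮ = hLiu418 = `stmt-HodgeConjecture-24832`; ROAD Φ of socket #41, TABLE #7 (h3), desk K2E5-p17 (g8) split 16:17:21Z: K2E4-p10 = KIND W's weighted growth `(w hw0 hws hg)`;
THIS FILE = piece (W3b) of the 16:22:26Z census — the ABSTRACT ASSEMBLY «Gaussian decay × height control × dual-lattice support ⇒ weighted growth with a summable weight».
THEOREMS ONLY (no `def`, no instance, no notation, no named-fact hypothesis, no `sorry`); hypothesis-first, Mathlib-level.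
-/
import Summits.HodgeConjecture.HodgeConjecture.Theorems.K2LiuExpDecayPolynomialWeight   -- ★ p861878 (this seat): the trade `e^{−aτ}(1+τ)^N ≤ (e^{a}(N+k)!∕a^{N+k})·((1+τ)^k)⁻¹`
import Mathlib.Analysis.PSeries
import HarnessLib

/-!
# Crux `HLiu418`, ROAD Φ of socket #41, (h3)∕(W3b) — `K2LiuWhittakerWeightedGrowthOfDecay`: THE KIND-W WEIGHTED GROWTH `‖E_S(s,h)‖ ≤ C(z)·w(S)·‖h‖^A` WITH A SUMMABLE WEIGHT
# `w(S) = (1+τ(S))^{−k}·d(S)^{−B}` FROM THREE LETTERS: archimedean decay, dual-lattice support, lattice count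

Cell `hodgecm-mathlib`, crux item hLiu418 = `stmt-HodgeConjecture-24832` (helper lane `--supports … --as helper`, count-neutral); squad K2 ∕ K2Liu, road `K2_Liu`, socket #41; consumers =
★ p861376∕p861446 (`hg`), ★ p861512 (`hws`), the TOP ★ ed. 8∕9 (F0P2-p08 (g0)'s `K2LiuSiegelEisensteinWhittakerFactorLetters` instantiates `E := WT·GW`).
THE MATHEMATICS ([Shimura1997, §18.4]; [MoeglinWaldspurger1995, I.2.2, IV.1.9]; [KudlaRallis1994, §1]; [BorelJacquet1979, §1.2]).  The TOP's Fourier index set is the full `L⁺`-space of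
skew-hermitian matrices (dense archimedeanly), so a weight summable over it must decay in the archimedean SIZE `τ(S)` AND in the DENOMINATOR `d(S)` (least `d ≥ 1` with `S ∈ d⁻¹Λ₀`).
Three letters, BY VALUE, on an abstract family `E : ι → ℂ → X → ℂ` with a height `H ≥ m > 0`: (L-dec) near every `z` (`0 < re z`), `‖E_i(s,x)‖ ≤ C·H(x)^A·e^{−c·H(x)^{−A′}·τ_i}·(1+τ_i)^N`
— the archimedean Whittaker GAUSSIAN decay `e^{−c·tr(S·yy*)}` (row G4 ★ Φ6b-5) with the Iwasawa eigenvalue already converted to height, `λ_min(yy*) ≥ H^{−A′}` (row G7 ★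
`K2LiuIwasawaHeightLatticeSumBound`); (L-supp) `E_i(s,x) ≠ 0 ⇒ d_i ≤ C₀·H(x)^κ` — the coefficient vanishes off the dual lattice of the level seen by `x_f` (row G3 ★
`whittakerLoc_eq_zero_of_not_mem_dualLattice`), whose denominators are bounded by the finite height; (L-cnt) for each `D ≥ 1`, `Σ_{d_i = D}(1+τ_i)^{−k} ≤ C₁·D^{k₁}` (lattice count in `D⁻¹Λ₀`,
★ `summable_one_add_norm_rpow_neg`).  THEN (§1) `‖E_i(s,x)‖ ≤ C′(z)·[(1+τ_i)^{−k}·d_i^{−B}]·H(x)^{A + A′(N+k) + κB}` for EVERY `k B : ℕ` — the trade ★ p861878 at `a = c·H^{−A′}`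
(`e^{a} ≤ e^{c·m^{−A′}}`, `a^{−(N+k)} = c^{−(N+k)}H^{A′(N+k)}`) and `1 ≤ (C₀H^κ∕d_i)^B` on the support — and (§2) `w_i := (1+τ_i)^{−k}·d_i^{−B}` is SUMMABLE once `B ≥ k₁ + 2`
(`Σ_D C₁D^{k₁−B} ≤ C₁Σ_D D^{−2}`), via `summable_sigma_of_nonneg` along the fibres of `d`.
* §1 **`weightedGrowth_of_decay_and_support`**.  * §2 **`summable_weight_of_latticeCount`**, `weight_nonneg`.
NOT HERE: the three letters themselves (rows G3∕G4∕G7 at F0P2-p08's `WT·GW`) — the instance is his `exists_whittaker_factorLetters`.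
HONEST LABEL.  Count-neutral helper; `HC_CM` is proved only modulo the 7 printed citations (2 remaining named inputs: hLiu418 = `stmt-HodgeConjecture-24832`,
h413 = `stmt-HodgeConjecture-24833`) until rung 0 closes.
-/

set_option autoImplicit false
set_option linter.dupNamespace false -- the mandated namespace repeats `HodgeConjecture.HodgeConjecture`

noncomputable section

namespace Summit.HodgeConjecture.HodgeConjecture.Cruxes.HLiu418.K2LiuWhittakerWeightedGrowthOfDecay

open Real Nat Metric
open scoped BigOperators
open K2LiuExpDecayPolynomialWeight (exp_neg_mul_one_add_pow_le)

variable {X : Type*} {ι : Type*}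

/-! ## §1 Weighted growth from decay and support -/

/-- **KIND-W WEIGHTED GROWTH FROM (L-dec) + (L-supp).**  Height `H` with floor `0 < m ≤ H`; sizes `τ_i ≥ 0`; denominators `d_i ≥ 1`; decay letter (L-dec) with a fixed polynomial
degree `N` and support letter (L-supp).  Then for every `k B : ℕ`: near every `z` with `0 < re z`,
`‖E_i(s,x)‖ ≤ C′·((1+τ_i)^k)⁻¹·(d_i^B)⁻¹·H(x)^{A + A′·(N+k) + κ·B}` for all `i`, `x` — the `hg` shape of the TOP with `w_i = ((1+τ_i)^k)⁻¹·(d_i^B)⁻¹`.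
[cite: Shimura1997, §18.4] [cite: MoeglinWaldspurger1995, IV.1.9] [cite: BorelJacquet1979, §1.2] -/
theorem weightedGrowth_of_decay_and_support (H : X → ℝ) {m : ℝ} (hm : 0 < m) (hfloor : ∀ x, m ≤ H x)
    (E : ι → ℂ → X → ℂ) (τ : ι → ℝ) (hτ : ∀ i, 0 ≤ τ i) (d : ι → ℕ) (hd : ∀ i, 1 ≤ d i) (N : ℕ)
    (hdec : ∀ z : ℂ, 0 < z.re → ∃ C A c A' r : ℝ, 0 ≤ C ∧ 0 ≤ A ∧ 0 < c ∧ 0 ≤ A' ∧ 0 < r ∧ ∀ i (s : ℂ), dist s z < r → ∀ x,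
      ‖E i s x‖ ≤ C * H x ^ A * (Real.exp (-(c * H x ^ (-A') * τ i)) * (1 + τ i) ^ N))
    {C₀ κ : ℝ} (hC₀ : 0 < C₀) (hκ : 0 ≤ κ) (hsupp : ∀ i (s : ℂ) x, E i s x ≠ 0 → (d i : ℝ) ≤ C₀ * H x ^ κ) (k B : ℕ) :
    ∀ z : ℂ, 0 < z.re → ∃ C A r : ℝ, 0 ≤ C ∧ 0 ≤ A ∧ 0 < r ∧ ∀ i (s : ℂ), dist s z < r → ∀ x,
      ‖E i s x‖ ≤ C * (((1 + τ i) ^ k)⁻¹ * ((d i : ℝ) ^ B)⁻¹) * H x ^ A := by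
  intro z hz
  obtain ⟨C, A, c, A', r, hC, hA, hc, hA', hr, hle⟩ := hdec z hz
  -- the constant: `C · (e^{c·m^{−A′}}·(N+k)!·c^{−(N+k)}) · C₀^B`
  refine ⟨C * (Real.exp (c * m ^ (-A')) * (N + k) ! / c ^ (N + k)) * C₀ ^ B, A + A' * (N + k) + κ * B, r,
    by positivity, by positivity, hr, fun i s hs x => ?_⟩
  have hHpos : 0 < H x := lt_of_lt_of_le hm (hfloor x)
  have hτi := hτ i
  have hu : (0 : ℝ) < 1 + τ i := by linarith
  have hdi : (0 : ℝ) < d i := by exact_mod_cast lt_of_lt_of_le zero_lt_one (hd i)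
  by_cases h0 : E i s x = 0
  · rw [h0, norm_zero]; positivity
  -- the decay parameter `a = c·H^{−A′}` and its window `0 < a ≤ c·m^{−A′}`
  set a : ℝ := c * H x ^ (-A') with ha_def
  have ha : 0 < a := mul_pos hc (Real.rpow_pos_of_pos hHpos _)
  have ham : a ≤ c * m ^ (-A') :=
    mul_le_mul_of_nonneg_left (Real.rpow_le_rpow_of_nonpos hm (hfloor x) (by linarith)) hc.le
  -- the trade (★ p861878) at `a`
  have htrade := exp_neg_mul_one_add_pow_le ha hτi N k
  -- `1∕a^{N+k} = c^{−(N+k)}·H^{A′(N+k)}`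
  have hainv : (a ^ (N + k))⁻¹ = (c ^ (N + k))⁻¹ * H x ^ (A' * (N + k)) := by
    rw [ha_def, mul_pow, mul_inv, ← Real.rpow_natCast (H x ^ (-A')), ← Real.rpow_mul hHpos.le, ← Real.rpow_neg hHpos.le]
    congr 1; congr 1; push_cast; ring
  -- support: `1 ≤ (C₀ H^κ)^B · (d_i^B)⁻¹`
  have hsup : (1 : ℝ) ≤ (C₀ * H x ^ κ) ^ B * ((d i : ℝ) ^ B)⁻¹ := by
    have h1 : (d i : ℝ) ≤ C₀ * H x ^ κ := hsupp i s x h0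
    rw [← div_eq_mul_inv, le_div_iff₀ (pow_pos hdi B), one_mul]
    exact pow_le_pow_left₀ hdi.le h1 B
  -- assemble
  have hexp : Real.exp a ≤ Real.exp (c * m ^ (-A')) := Real.exp_le_exp.2 ham
  have hfac : (0 : ℝ) < (N + k) ! := by exact_mod_cast Nat.factorial_pos (N + k)
  calc ‖E i s x‖ ≤ C * H x ^ A * (Real.exp (-(a * τ i)) * (1 + τ i) ^ N) := hle i s hs x
    _ ≤ C * H x ^ A * ((Real.exp a * (N + k) ! / a ^ (N + k)) * ((1 + τ i) ^ k)⁻¹) :=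
        mul_le_mul_of_nonneg_left htrade (by positivity)
    _ = C * H x ^ A * ((Real.exp a * (N + k) ! * ((c ^ (N + k))⁻¹ * H x ^ (A' * (N + k)))) * ((1 + τ i) ^ k)⁻¹) := by
        rw [div_eq_mul_inv, hainv]
    _ ≤ C * H x ^ A * ((Real.exp (c * m ^ (-A')) * (N + k) ! * ((c ^ (N + k))⁻¹ * H x ^ (A' * (N + k)))) * ((1 + τ i) ^ k)⁻¹) := by
        gcongr
    _ = (C * (Real.exp (c * m ^ (-A')) * (N + k) ! / c ^ (N + k))) * ((1 + τ i) ^ k)⁻¹ * (H x ^ A * H x ^ (A' * (N + k))) * 1 := by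
        rw [div_eq_mul_inv]; ring
    _ ≤ (C * (Real.exp (c * m ^ (-A')) * (N + k) ! / c ^ (N + k))) * ((1 + τ i) ^ k)⁻¹ * (H x ^ A * H x ^ (A' * (N + k))) *
          ((C₀ * H x ^ κ) ^ B * ((d i : ℝ) ^ B)⁻¹) :=
        mul_le_mul_of_nonneg_left hsup (by positivity)
    _ = C * (Real.exp (c * m ^ (-A')) * (N + k) ! / c ^ (N + k)) * C₀ ^ B * (((1 + τ i) ^ k)⁻¹ * ((d i : ℝ) ^ B)⁻¹) *
          (H x ^ A * H x ^ (A' * (N + k)) * (H x ^ κ) ^ B) := by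
        rw [mul_pow]; ring
    _ = C * (Real.exp (c * m ^ (-A')) * (N + k) ! / c ^ (N + k)) * C₀ ^ B * (((1 + τ i) ^ k)⁻¹ * ((d i : ℝ) ^ B)⁻¹) *
          H x ^ (A + A' * (N + k) + κ * B) := by
        rw [← Real.rpow_natCast (H x ^ κ), ← Real.rpow_mul hHpos.le, ← Real.rpow_add hHpos, ← Real.rpow_add hHpos]

/-! ## §2 Summability of the weight from the lattice count -/

/-- the weight `w_i = ((1+τ_i)^k)⁻¹·(d_i^B)⁻¹` is non-negative (`τ_i ≥ 0`). [folklore] -/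
theorem weight_nonneg (τ : ι → ℝ) (hτ : ∀ i, 0 ≤ τ i) (d : ι → ℕ) (k B : ℕ) (i : ι) :
    0 ≤ ((1 + τ i) ^ k)⁻¹ * ((d i : ℝ) ^ B)⁻¹ := by
  have := hτ i
  positivity

/-- **SUMMABILITY OF THE WEIGHT FROM (L-cnt).**  If for every `D ≥ 1` the size-weights over the fibre `{d_i = D}` are summable with `Σ (1+τ_i)^{−k} ≤ C₁·D^{k₁}` (lattice count in
`D⁻¹Λ₀`), then `w_i = ((1+τ_i)^k)⁻¹·(d_i^B)⁻¹` is summable over ALL `i` as soon as `k₁ + 2 ≤ B` (`Σ_D C₁·D^{k₁−B} ≤ C₁·Σ_D D^{−2} < ∞`; `summable_sigma_of_nonneg` along the fibres of `d`).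
[cite: MoeglinWaldspurger1995, I.2.2] [cite: KudlaRallis1994, §1] -/
theorem summable_weight_of_latticeCount (τ : ι → ℝ) (hτ : ∀ i, 0 ≤ τ i) (d : ι → ℕ) (hd : ∀ i, 1 ≤ d i) (k : ℕ) {C₁ : ℝ} (hC₁ : 0 ≤ C₁) {k₁ B : ℕ}
    (hB : k₁ + 2 ≤ B)
    (hcnt : ∀ D : ℕ, 1 ≤ D → Summable (fun i : {i : ι // d i = D} => ((1 + τ i.1) ^ k)⁻¹) ∧
      ∑' i : {i : ι // d i = D}, ((1 + τ i.1) ^ k)⁻¹ ≤ C₁ * (D : ℝ) ^ k₁) :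
    Summable fun i : ι => ((1 + τ i) ^ k)⁻¹ * ((d i : ℝ) ^ B)⁻¹ := by
  have hw0 : ∀ i, 0 ≤ ((1 + τ i) ^ k)⁻¹ * ((d i : ℝ) ^ B)⁻¹ := weight_nonneg τ hτ d k B
  -- along the fibres of `d`
  refine (Equiv.sigmaFiberEquiv d).summable_iff.1 ?_
  have hf0 : ∀ p : (Σ D : ℕ, {i : ι // d i = D}), 0 ≤ ((fun i : ι => ((1 + τ i) ^ k)⁻¹ * ((d i : ℝ) ^ B)⁻¹) ∘ Equiv.sigmaFiberEquiv d) p :=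
    fun p => hw0 _
  refine (summable_sigma_of_nonneg hf0).2 ⟨fun D => ?_, ?_⟩
  · -- each fibre: a constant multiple of the size-weights (empty fibre at `D = 0`)
    rcases Nat.eq_zero_or_pos D with rfl | hD
    · haveI : IsEmpty {i : ι // d i = 0} := ⟨fun i => by have := hd i.1; have := i.2; omega⟩
      exact summable_empty
    · refine (((hcnt D hD).1).mul_right (((D : ℝ) ^ B)⁻¹)).congr fun i => ?_
      simp only [Function.comp_apply, Equiv.sigmaFiberEquiv_apply, i.2]
  · -- the fibre sums: `≤ C₁·D^{k₁}·D^{−B} ≤ C₁·D^{−2}`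
    have hmajor : Summable fun D : ℕ => C₁ * ((D : ℝ) ^ 2)⁻¹ :=
      ((Real.summable_nat_pow_inv.2 one_lt_two)).mul_left C₁
    refine Summable.of_nonneg_of_le (fun D => tsum_nonneg fun i => hf0 _) (fun D => ?_) hmajor
    rcases Nat.eq_zero_or_pos D with rfl | hD
    · haveI : IsEmpty {i : ι // d i = 0} := ⟨fun i => by have := hd i.1; have := i.2; omega⟩
      rw [tsum_empty]; positivity
    · have hDpos : (0 : ℝ) < D := by exact_mod_cast hD
      have heq : (fun i : {i : ι // d i = D} => ((fun i : ι => ((1 + τ i) ^ k)⁻¹ * ((d i : ℝ) ^ B)⁻¹) ∘ Equiv.sigmaFiberEquiv d) ⟨D, i⟩) =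
          fun i : {i : ι // d i = D} => ((1 + τ i.1) ^ k)⁻¹ * (((D : ℝ) ^ B)⁻¹) := by
        funext i; simp only [Function.comp_apply, Equiv.sigmaFiberEquiv_apply, i.2]
      rw [heq, tsum_mul_right]
      calc (∑' i : {i : ι // d i = D}, ((1 + τ i.1) ^ k)⁻¹) * ((D : ℝ) ^ B)⁻¹ ≤ C₁ * (D : ℝ) ^ k₁ * ((D : ℝ) ^ B)⁻¹ :=
            mul_le_mul_of_nonneg_right (hcnt D hD).2 (by positivity)
        _ ≤ C₁ * ((D : ℝ) ^ 2)⁻¹ := by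
            rw [mul_assoc]
            refine mul_le_mul_of_nonneg_left ?_ hC₁
            -- `D^{k₁}·D^{−B} ≤ D^{−2}` since `k₁ + 2 ≤ B` and `1 ≤ D`
            have hD1 : (1 : ℝ) ≤ D := by exact_mod_cast hD
            have hsplit : (D : ℝ) ^ B = (D : ℝ) ^ k₁ * (D : ℝ) ^ 2 * (D : ℝ) ^ (B - k₁ - 2) := by
              rw [← pow_add, ← pow_add]; congr 1; omega
            have hge : (D : ℝ) ^ k₁ * (D : ℝ) ^ 2 ≤ (D : ℝ) ^ B := by
              rw [hsplit]; exact le_mul_of_one_le_right (by positivity) (one_le_pow₀ hD1)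
            calc (D : ℝ) ^ k₁ * ((D : ℝ) ^ B)⁻¹ = (D : ℝ) ^ k₁ / (D : ℝ) ^ B := by rw [div_eq_mul_inv]
              _ ≤ (D : ℝ) ^ k₁ / ((D : ℝ) ^ k₁ * (D : ℝ) ^ 2) := div_le_div_of_nonneg_left (by positivity) (by positivity) hge
              _ = ((D : ℝ) ^ 2)⁻¹ := by rw [← div_div, div_self (pow_ne_zero _ hDpos.ne'), one_div]

end Summit.HodgeConjecture.HodgeConjecture.Cruxes.HLiu418.K2LiuWhittakerWeightedGrowthOfDecay

end
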